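import Summits.AtomisticToContinuum.Crystallization.Theorems.ChargedEnergyGap.Negative.BlocksTails
import Literature.MathematicalPhysics.StatisticalMechanics.LennardJonesThermodynamicLimitProofs
import Literature.Barriers.AtomisticToContinuum.SutoDegenerateGroundStates

/-!
# Blocks of a periodic configuration III: item 0714 and the trial-state bound 11865

At most `6ρ'K²` lattice coordinates of `[0,K)³` are not `ρ'`-deep, so the sixth-power tails of a
block sum to `≤ K³·farSum(ρ) + 6ρ'(ρ)K²·sixSum = o(K³)`.  Consequences:
`Blocks.neg_le_energyPerParticle` (`e(Q) ≥ −2³²/12` for EVERY periodic `Q`),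
**`bddBelow_energyPerParticle_lennardJones`** (item 0714 `CrysPeriodicBddBelow`),
`exists_trialState` (finite configurations approach `e* = ⨅ e` from above) and
`limsup_div_le_energyPerParticle` (`limsup E(N)/N ≤ e(Q)` for every periodic `Q`, via the
thermodynamic limit `BlancLewin2015_8_holds`; item 11865 `CrysEnergyUpper` is its `le_ciInf`, left
to a prover as the refuter may not land the route decl itself).  All `[folklore]`.
-/

noncomputable section

namespace Summit.AtomisticToContinuum.Crystallization.Theorems.ChargedEnergyGapNegative

open Literature.MathematicalPhysics.StatisticalMechanics
open scoped BigOperators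

namespace Blocks

variable (Q : PeriodicConfiguration 3)

variable (K : ℕ)

/-! ### Counting non-deep lattice coordinates -/

/-- Fixing the value range of one coordinate: `#{k | P (k i)} = #{a | P a} · K²`. [folklore] -/
theorem card_coord_eq (i : Fin 3) (P : Fin K → Prop) [DecidablePred P] :
    Fintype.card {k : Fin 3 → Fin K // P (k i)} = Fintype.card {a : Fin K // P a} * K ^ 2 := by
  let e := (Fin.insertNthEquiv (fun _ : Fin 3 => Fin K) i).symm
  have h1 : Fintype.card {k : Fin 3 → Fin K // P (k i)} =
      Fintype.card {p : Fin K × (Fin 2 → Fin K) // P p.1} := by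
    refine Fintype.card_congr (e.subtypeEquiv fun k => ?_)
    simp [e]
  rw [h1, Fintype.card_congr (Equiv.prodSubtypeFstEquivSubtypeProd (p := P)),
    Fintype.card_prod, Fintype.card_fun, Fintype.card_fin, Fintype.card_fin]

/-- `#{a : Fin K | a < ρ'} ≤ ρ'`. [folklore] -/
theorem card_lt_le (ρ' : ℕ) : Fintype.card {a : Fin K // (a : ℕ) < ρ'} ≤ ρ' := by
  have := Fintype.card_le_of_injective
    (fun a : {a : Fin K // (a : ℕ) < ρ'} => (⟨(a.1 : ℕ), a.2⟩ : Fin ρ'))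
    (fun a b h => by
      have := congrArg Fin.val h
      exact Subtype.ext (Fin.ext this))
  simpa using this

/-- `#{a : Fin K | K ≤ a + ρ'} ≤ ρ'`. [folklore] -/
theorem card_ge_le (ρ' : ℕ) : Fintype.card {a : Fin K // K ≤ (a : ℕ) + ρ'} ≤ ρ' := by
  have := Fintype.card_le_of_injective
    (fun a : {a : Fin K // K ≤ (a : ℕ) + ρ'} =>
      (⟨K - 1 - (a.1 : ℕ), by have := a.2; have := a.1.2; omega⟩ : Fin ρ'))
    (fun a b h => by
      have h' := congrArg Fin.val h
      simp only at h'
      have := a.2; have := b.2; have := a.1.2; have := b.1.2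
      exact Subtype.ext (Fin.ext (by omega)))
  simpa using this

/-- Non-deep coordinates have some coordinate near a face. [folklore] -/
theorem not_isDeep_iff {ρ' : ℕ} {k : Fin 3 → Fin K} :
    ¬ IsDeep K ρ' k ↔ ∃ i, (k i : ℕ) < ρ' ∨ K ≤ (k i : ℕ) + ρ' := by
  unfold IsDeep
  push Not
  refine exists_congr fun i => ?_
  constructor
  · intro h
    by_cases h1 : ρ' ≤ (k i : ℕ)
    · exact Or.inr (h h1)
    · exact Or.inl (by omega)
  · rintro (h | h) h1
    · omega
    · exact h

/-- **At most `6ρ'K²` lattice coordinates are not `ρ'`-deep.** [folklore] -/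
theorem card_not_deep_le (ρ' : ℕ) :
    (Finset.univ.filter fun k : Fin 3 → Fin K => ¬ IsDeep K ρ' k).card ≤ 6 * ρ' * K ^ 2 := by
  classical
  have hsub : (Finset.univ.filter fun k : Fin 3 → Fin K => ¬ IsDeep K ρ' k) ⊆
      Finset.univ.biUnion fun i : Fin 3 =>
        (Finset.univ.filter fun k : Fin 3 → Fin K => (k i : ℕ) < ρ') ∪
          (Finset.univ.filter fun k : Fin 3 → Fin K => K ≤ (k i : ℕ) + ρ') := by
    intro k hk
    rw [Finset.mem_filter] at hk
    obtain ⟨i, hi⟩ := not_isDeep_iff K |>.1 hk.2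
    refine Finset.mem_biUnion.2 ⟨i, Finset.mem_univ i, ?_⟩
    rcases hi with hi | hi
    · exact Finset.mem_union_left _ (Finset.mem_filter.2 ⟨Finset.mem_univ k, hi⟩)
    · exact Finset.mem_union_right _ (Finset.mem_filter.2 ⟨Finset.mem_univ k, hi⟩)
  refine (Finset.card_le_card hsub).trans ((Finset.card_biUnion_le).trans ?_)
  have hi : ∀ i : Fin 3,
      ((Finset.univ.filter fun k : Fin 3 → Fin K => (k i : ℕ) < ρ') ∪
          (Finset.univ.filter fun k : Fin 3 → Fin K => K ≤ (k i : ℕ) + ρ')).card ≤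
        2 * ρ' * K ^ 2 := by
    intro i
    refine (Finset.card_union_le _ _).trans ?_
    have h1 : (Finset.univ.filter fun k : Fin 3 → Fin K => (k i : ℕ) < ρ').card ≤ ρ' * K ^ 2 := by
      rw [← Fintype.card_subtype, card_coord_eq K i (fun a => (a : ℕ) < ρ')]
      exact Nat.mul_le_mul_right _ (card_lt_le K ρ')
    have h2 : (Finset.univ.filter fun k : Fin 3 → Fin K => K ≤ (k i : ℕ) + ρ').card ≤
        ρ' * K ^ 2 := by
      rw [← Fintype.card_subtype, card_coord_eq K i (fun a => K ≤ (a : ℕ) + ρ')]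
      exact Nat.mul_le_mul_right _ (card_ge_le K ρ')
    linarith
  calc ∑ i : Fin 3, ((Finset.univ.filter fun k : Fin 3 → Fin K => (k i : ℕ) < ρ') ∪
          (Finset.univ.filter fun k : Fin 3 → Fin K => K ≤ (k i : ℕ) + ρ')).card
      ≤ ∑ _i : Fin 3, 2 * ρ' * K ^ 2 := Finset.sum_le_sum fun i _ => hi i
    _ = 6 * ρ' * K ^ 2 := by simp; ring

/-! ### The average tail is small -/

/-- Sum of the far parts over the motif. [folklore] -/
def farSum (ρ : ℝ) : ℝ := ∑ x ∈ Q.motif, farSix Q x ρ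

/-- Sum of the full sixth-power site sums over the motif. [folklore] -/
def sixSum : ℝ := ∑ x ∈ Q.motif, siteSum Q six x

/-- `0 ≤ farSix`. [folklore] -/
theorem farSix_nonneg (x : E3) (ρ : ℝ) : 0 ≤ farSix Q x ρ := tsum_nonneg fun _ => six_nonneg _

/-- `0 ≤ siteSum six`. [folklore] -/
theorem siteSum_six_nonneg (x : E3) : 0 ≤ siteSum Q six x := tsum_nonneg fun _ => six_nonneg _

/-- `0 ≤ sixSum`. [folklore] -/
theorem sixSum_nonneg : 0 ≤ sixSum Q := Finset.sum_nonneg fun x _ => siteSum_six_nonneg Q x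

/-- **The far sums tend to zero.** [folklore] -/
theorem exists_farSum_le {ε : ℝ} (hε : 0 < ε) : ∃ ρ₀ : ℝ, ∀ ρ, ρ₀ ≤ ρ → farSum Q ρ ≤ ε := by
  have hF : (0 : ℝ) < Q.motif.card := by exact_mod_cast Q.motif_nonempty.card_pos
  have hε' : 0 < ε / Q.motif.card := div_pos hε hF
  choose ρx hρx using fun x : E3 => exists_farSix_lt Q x hε'
  refine ⟨∑ x ∈ Q.motif, |ρx x|, fun ρ hρ => ?_⟩
  have hle : ∀ x ∈ Q.motif, farSix Q x ρ ≤ ε / Q.motif.card := by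
    intro x hx
    have h1 := Finset.single_le_sum (s := Q.motif) (f := fun x => |ρx x|) (fun _ _ => abs_nonneg _) hx
    exact (hρx x ρ ((le_abs_self _).trans (h1.trans hρ))).le
  calc farSum Q ρ ≤ ∑ _x ∈ Q.motif, ε / Q.motif.card := Finset.sum_le_sum hle
    _ = ε := by rw [Finset.sum_const, nsmul_eq_mul]; field_simp

/-- Pointwise bound: the sixth-power tail at `u = (x, k)` is at most `farSix x ρ` if `k` is
`ρ'(ρ)`-deep and at most `siteSum six x` otherwise. [folklore] -/
theorem tailSix_le_ite (ρ : ℝ) (u : BIdx Q K) :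
    tailSix Q K u ≤ farSix Q u.1 ρ +
      (if ¬ IsDeep K (depth Q ρ) u.2 then 1 else 0) * siteSum Q six u.1 := by
  by_cases h : IsDeep K (depth Q ρ) u.2
  · rw [if_neg (not_not_intro h), zero_mul, add_zero]
    exact tailSix_le_farSix Q K u (fun q hq => le_dist_of_deep Q K h q hq)
  · rw [if_pos h, one_mul]
    exact (tailSix_le_siteSum Q K u).trans (le_add_of_nonneg_left (farSix_nonneg Q _ _))

/-- **Sum of the sixth-power tails over a block**:
`Σ_u tailSix u ≤ K³·farSum(ρ) + 6ρ'(ρ)K²·sixSum`. [folklore] -/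
theorem sum_tailSix_le (ρ : ℝ) :
    ∑ u : BIdx Q K, tailSix Q K u ≤
      (K : ℝ) ^ 3 * farSum Q ρ + 6 * (depth Q ρ) * (K : ℝ) ^ 2 * sixSum Q := by
  classical
  have hnd := card_not_deep_le K (depth Q ρ)
  calc ∑ u : BIdx Q K, tailSix Q K u
      ≤ ∑ u : BIdx Q K, (farSix Q u.1 ρ +
          (if ¬ IsDeep K (depth Q ρ) u.2 then 1 else 0) * siteSum Q six u.1) :=
        Finset.sum_le_sum fun u _ => tailSix_le_ite Q K ρ u
    _ = ∑ x : Q.motif, ((K : ℝ) ^ 3 * farSix Q x ρ +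
          ((Finset.univ.filter fun k : Fin 3 → Fin K => ¬ IsDeep K (depth Q ρ) k).card : ℝ) *
            siteSum Q six x) := by
        rw [Fintype.sum_prod_type]
        refine Finset.sum_congr rfl fun x _ => ?_
        dsimp only
        rw [Finset.sum_add_distrib, Finset.sum_const, Finset.card_univ, Fintype.card_fun,
          Fintype.card_fin, Fintype.card_fin, nsmul_eq_mul, ← Finset.sum_mul, Finset.sum_boole]
        push_cast
        ring
    _ ≤ ∑ x : Q.motif, ((K : ℝ) ^ 3 * farSix Q x ρ + (6 * (depth Q ρ) * (K : ℝ) ^ 2) *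
          siteSum Q six x) := by
        refine Finset.sum_le_sum fun x _ => add_le_add le_rfl ?_
        exact mul_le_mul_of_nonneg_right (by exact_mod_cast hnd) (siteSum_six_nonneg Q x)
    _ = (K : ℝ) ^ 3 * farSum Q ρ + 6 * (depth Q ρ) * (K : ℝ) ^ 2 * sixSum Q := by
        rw [Finset.sum_add_distrib, ← Finset.mul_sum, ← Finset.mul_sum]
        unfold farSum sixSum
        rw [Finset.sum_coe_sort Q.motif (fun x => farSix Q x ρ),
          Finset.sum_coe_sort Q.motif (fun x => siteSum Q six x)]

/-- **The average sixth-power tail is eventually small**: for every `ε > 0` there is `K₀ ≥ 1`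
with `Σ_u tailSix u ≤ ε · (2 #F K³)` for all `K ≥ K₀`. [folklore] -/
theorem exists_sum_tailSix_le {ε : ℝ} (hε : 0 < ε) :
    ∃ K₀ : ℕ, 0 < K₀ ∧ ∀ K : ℕ, K₀ ≤ K →
      ∑ u : BIdx Q K, tailSix Q K u ≤ ε * (2 * Q.motif.card * (K : ℝ) ^ 3) := by
  have hF : (0 : ℝ) < Q.motif.card := by exact_mod_cast Q.motif_nonempty.card_pos
  obtain ⟨ρ₀, hρ₀⟩ := exists_farSum_le Q (show 0 < ε * Q.motif.card by positivity)
  set ρ := ρ₀ with hρ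
  have hfar : farSum Q ρ ≤ ε * Q.motif.card := hρ₀ ρ le_rfl
  -- `K₀` beats the boundary term: `6ρ' sixSum ≤ ε #F K`
  obtain ⟨K₀, hK₀⟩ := exists_nat_gt (6 * (depth Q ρ) * sixSum Q / (ε * Q.motif.card))
  refine ⟨K₀ + 1, Nat.succ_pos _, fun K hK => ?_⟩
  have hK1 : (1 : ℝ) ≤ K := by exact_mod_cast (show 1 ≤ K by omega)
  have hKpos : (0 : ℝ) < K := by linarith
  have hK' : 6 * (depth Q ρ) * sixSum Q / (ε * Q.motif.card) < K := by
    have : (K₀ : ℝ) < K := by exact_mod_cast Nat.lt_of_lt_of_le (Nat.lt_succ_self K₀) hK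
    linarith
  have hbd : 6 * (depth Q ρ) * sixSum Q ≤ ε * Q.motif.card * K := by
    rw [div_lt_iff₀ (by positivity)] at hK'
    linarith
  calc ∑ u : BIdx Q K, tailSix Q K u
      ≤ (K : ℝ) ^ 3 * farSum Q ρ + 6 * (depth Q ρ) * (K : ℝ) ^ 2 * sixSum Q := sum_tailSix_le Q K ρ
    _ ≤ (K : ℝ) ^ 3 * (ε * Q.motif.card) + (K : ℝ) ^ 2 * (ε * Q.motif.card * K) := by
        have h1 : (K : ℝ) ^ 3 * farSum Q ρ ≤ (K : ℝ) ^ 3 * (ε * Q.motif.card) :=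
          mul_le_mul_of_nonneg_left hfar (by positivity)
        have h2 : 6 * (depth Q ρ) * (K : ℝ) ^ 2 * sixSum Q ≤ (K : ℝ) ^ 2 * (ε * Q.motif.card * K) := by
          have := mul_le_mul_of_nonneg_left hbd (by positivity : (0 : ℝ) ≤ (K : ℝ) ^ 2)
          linarith [this]
        linarith
    _ = ε * (2 * Q.motif.card * (K : ℝ) ^ 3) := by ring

/-! ### Conclusions: periodic energies are bounded below; blocks are trial states -/

/-- **Every periodic Lennard-Jones energy per particle is at least `−2³²/12`.** [folklore] -/
theorem neg_le_energyPerParticle : -(65536 ^ 2 / 12 : ℝ) ≤ Q.energyPerParticle lennardJones := by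
  refine le_of_forall_pos_le_add fun ε hε => ?_
  obtain ⟨K₀, hK₀, hK⟩ := exists_sum_tailSix_le Q (show 0 < 6 * ε by positivity)
  have hF : (0 : ℝ) < Q.motif.card := by exact_mod_cast Q.motif_nonempty.card_pos
  have hsum := hK K₀ le_rfl
  have hge := energyPerParticle_ge_tail Q hK₀
  have hK₀r : (0 : ℝ) < (K₀ : ℝ) ^ 3 := by positivity
  have hpos : (0 : ℝ) < 2 * Q.motif.card * (K₀ : ℝ) ^ 3 := by positivity
  -- tails ≥ −(1/6)·tailSix termwise
  have htail : -(1 / 6 * ∑ u : BIdx Q K₀, tailSix Q K₀ u) ≤ ∑ u : BIdx Q K₀, tail Q K₀ lennardJones u := by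
    rw [Finset.mul_sum, ← Finset.sum_neg_distrib]
    exact Finset.sum_le_sum fun u _ => neg_tailSix_le_tail Q K₀ u
  have h1 : -(1 / 6 * (6 * ε * (2 * Q.motif.card * (K₀ : ℝ) ^ 3))) ≤
      ∑ u : BIdx Q K₀, tail Q K₀ lennardJones u := by nlinarith
  have h2 : -ε ≤ (∑ u : BIdx Q K₀, tail Q K₀ lennardJones u) / (2 * Q.motif.card * (K₀ : ℝ) ^ 3) := by
    rw [le_div_iff₀ hpos]; nlinarith
  linarith

/-- **Blocks are trial states**: for every `ε > 0`, all large blocks have energy per particle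
at most `e(Q) + ε`. [folklore] -/
theorem exists_block_energy_le {ε : ℝ} (hε : 0 < ε) :
    ∃ K₀ : ℕ, 0 < K₀ ∧ ∀ K : ℕ, K₀ ≤ K →
      interactionEnergy lennardJones (blockConfig Q K) ≤
        (Fintype.card (BIdx Q K) : ℝ) * (Q.energyPerParticle lennardJones + ε) := by
  obtain ⟨K₀, hK₀, hK⟩ := exists_sum_tailSix_le Q (show 0 < 6 * ε by positivity)
  refine ⟨K₀, hK₀, fun K hKK => ?_⟩
  have hsum := hK K hKK
  have hid := two_mul_energy_block_eq Q K
  have htail : -(1 / 6 * ∑ u : BIdx Q K, tailSix Q K u) ≤ ∑ u : BIdx Q K, tail Q K lennardJones u := by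
    rw [Finset.mul_sum, ← Finset.sum_neg_distrib]
    exact Finset.sum_le_sum fun u _ => neg_tailSix_le_tail Q K u
  have hn : ((Fintype.card (BIdx Q K) : ℕ) : ℝ) = Q.motif.card * (K : ℝ) ^ 3 := by
    exact_mod_cast card_BIdx Q K
  rw [hn]
  nlinarith

end Blocks

/-! ## Item 0714 and the trial-state upper bound (item 11865) -/

open Literature.Barriers.AtomisticToContinuum (bravaisConfiguration cubicLattice)

/-- There are periodic configurations of `ℝ³` (e.g. the simple cubic lattice). [folklore] -/
instance instNonemptyPeriodicConfiguration : Nonempty (PeriodicConfiguration 3) :=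
  ⟨bravaisConfiguration (cubicLattice 1) 0⟩

/-- **Item 0714 `CrysPeriodicBddBelow`**: the Lennard-Jones energies per particle of periodic
configurations of `ℝ³` are bounded below (by `−2³²/12`, from finite stability through blocks);
so `e* = ⨅ e` is a genuine infimum. [folklore] -/
theorem bddBelow_energyPerParticle_lennardJones :
    BddBelow (Set.range fun Q : PeriodicConfiguration 3 => Q.energyPerParticle lennardJones) :=
  ⟨-(65536 ^ 2 / 12 : ℝ), by rintro _ ⟨Q, rfl⟩; exact Blocks.neg_le_energyPerParticle Q⟩

/-- Hence `e* ≤ e(Q)` for every periodic `Q`. [folklore] -/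
theorem eStar_le (Q : PeriodicConfiguration 3) : eStar ≤ Q.energyPerParticle lennardJones :=
  ciInf_le bddBelow_energyPerParticle_lennardJones Q

/-- **Finite trial states approach `e*` from above**: for every `δ > 0` there are `N ≥ 1`
distinct points with `E_LJ < N(e* + δ)` (a large block of a near-optimal periodic
configuration). [folklore] -/
theorem exists_trialState {δ : ℝ} (hδ : 0 < δ) :
    ∃ (N : ℕ) (y : Fin N → E3), 0 < N ∧ Function.Injective y ∧
      interactionEnergy lennardJones y < (N : ℝ) * (eStar + δ) := by
  have hlt : eStar < eStar + δ / 2 := by linarith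
  obtain ⟨Q, hQ⟩ := exists_lt_of_ciInf_lt hlt
  obtain ⟨K₀, hK₀, hK⟩ := Blocks.exists_block_energy_le Q (show 0 < δ / 4 by positivity)
  refine ⟨Fintype.card (Blocks.BIdx Q K₀), Blocks.blockConfig Q K₀, ?_,
    Blocks.blockConfig_injective Q K₀, ?_⟩
  · rw [Blocks.card_BIdx]
    exact Nat.mul_pos Q.motif_nonempty.card_pos (pow_pos hK₀ 3)
  · have h := hK K₀ le_rfl
    have hn : (0 : ℝ) < Fintype.card (Blocks.BIdx Q K₀) := by
      rw [Blocks.card_BIdx]; exact_mod_cast Nat.mul_pos Q.motif_nonempty.card_pos (pow_pos hK₀ 3)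
    have : (Fintype.card (Blocks.BIdx Q K₀) : ℝ) * (Q.energyPerParticle lennardJones + δ / 4) <
        (Fintype.card (Blocks.BIdx Q K₀) : ℝ) * (eStar + δ) :=
      mul_lt_mul_of_pos_left (by linarith) hn
    exact h.trans_lt this

/-- **The trial-state upper bound, per periodic configuration**:
`limsup E(N)/N ≤ e(Q)` for every periodic `Q` (Lennard-Jones, `ℝ³`).  By the thermodynamic
limit (`BlancLewin2015_8_holds`: `E(N)/N → e_∞` with `e_∞ ≤ E(N)/N` for all `N ≥ 1`) the limsup
is `e_∞`, and `e_∞ ≤ E(block)/#block ≤ e(Q) + ε`.  Item 11865 `CrysEnergyUpper`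
(`limsup ≤ ⨅ e`) is `le_ciInf` of this — the prover's one-liner. [folklore] -/
theorem limsup_div_le_energyPerParticle (Q : PeriodicConfiguration 3) :
    Filter.limsup (fun N : ℕ => groundStateEnergy lennardJones 3 N / N) Filter.atTop ≤
      Q.energyPerParticle lennardJones := by
  obtain ⟨e, -, htend, hle⟩ := BlancLewin2015_8_holds 3 (by norm_num) (by norm_num)
  rw [htend.limsup_eq]
  refine le_of_forall_pos_le_add fun ε hε => ?_
  obtain ⟨K₀, hK₀, hK⟩ := Blocks.exists_block_energy_le Q hε
  have hnpos : 0 < Fintype.card (Blocks.BIdx Q K₀) := by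
    rw [Blocks.card_BIdx]; exact Nat.mul_pos Q.motif_nonempty.card_pos (pow_pos hK₀ 3)
  have hn : (0 : ℝ) < Fintype.card (Blocks.BIdx Q K₀) := by exact_mod_cast hnpos
  have h1 := hle _ hnpos
  have h2 : groundStateEnergy lennardJones 3 (Fintype.card (Blocks.BIdx Q K₀)) ≤
      interactionEnergy lennardJones (Blocks.blockConfig Q K₀) :=
    groundStateEnergy_lennardJones_le (Blocks.blockConfig_injective Q K₀)
  have h3 := hK K₀ le_rfl
  rw [le_div_iff₀ hn] at h1
  nlinarith

/-- The thermodynamic limit `e_∞` is at most every periodic energy per particle, in `Tendsto`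
form: if `E(N)/N → e` then `e ≤ e(Q)`. [folklore] -/
theorem le_energyPerParticle_of_tendsto {e : ℝ}
    (htend : Filter.Tendsto (fun N : ℕ => groundStateEnergy lennardJones 3 N / N) Filter.atTop
      (nhds e)) (Q : PeriodicConfiguration 3) :
    e ≤ Q.energyPerParticle lennardJones := by
  have := limsup_div_le_energyPerParticle Q
  rwa [htend.limsup_eq] at this

end Summit.AtomisticToContinuum.Crystallization.Theorems.ChargedEnergyGapNegative

end
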